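import Summits.CriticalPhenomena.PercolationContinuityZ3.Theorems.SahiBoxTP2HilbertCoupling
import Summits.CriticalPhenomena.PercolationContinuityZ3.Theorems.SahiBoxTP2HilbertImage

/-!
# Sahi's conjecture `C_n` ⟺ every box-TP₂ law on the Hilbert cube `ℕ → [0,1]` is Sahi-positive of order `n`

Support file of the Sahi cell (`prim-sahi`, typer seat, generation 12; `--supports stmt-CriticalPhenomena-4575`).
Infinite-dimensional version of generation 11's `SahiBoxTP2Positivity.lean`.

Call a probability measure `μ` on the Hilbert cube `ℕ → [0,1]` (coordinatewise order) BOX-TP₂ if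
`μ[a,b]·μ[a',b'] ≤ μ[a ⊓ a', b ⊓ b']·μ[a ⊔ a', b ⊔ b']` for all closed boxes (`SahiBoxTP2Split.IsBoxTP2`), equivalently
(`SahiBoxTP2HilbertMarginals.isBoxTP2_iff_forall_map_finRestrict_unitInterval`) if every finite-dimensional marginal
is box-TP₂ on `Q_d` — "all finite-dimensional distributions are MTP₂", intrinsic for singular laws.

* `msahiE_nonneg_of_isBoxTP2_hilbert` — **if Lieb–Sahi's continuous case `LiebSahiContinuum d n` holds for every
  `d` (⟺ `SahiConjecture n`), then every box-TP₂ probability measure on `ℕ → [0,1]` satisfies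
  `E_n(f_0,…,f_{n−1}) ≥ 0` for ALL measurable nonnegative monotone `f_i`** (the coupling theorem
  `exists_aemonotone_coupling_hilbert` + `msahiE_map_lebesgueHilbert_nonneg_of_monotoneOn`); `…_of_sahiConjecture`;
  `…_antitone` (Lieb–Sahi's printed orientation, by the coordinatewise reflection `reflectHilbert`, which preserves
  box-TP₂, `IsBoxTP2.map_reflectHilbert`).
* UNCONDITIONALLY `n ≤ 2` (`msahiE_nonneg_of_isBoxTP2_hilbert_of_le_two`): **the FKG inequality for every box-TP₂
  law on the Hilbert cube**, `∫ f ∫ g ≤ ∫ f g` for measurable nonnegative monotone `f, g`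
  (`integral_mul_integral_le_of_isBoxTP2_hilbert`) — positive association of singular infinite-dimensional MTP₂ laws.
* `sahiConjecture_iff_forall_isBoxTP2_hilbert` — **`SahiConjecture n` ⟺ every box-TP₂ probability measure on the
  Hilbert cube is Sahi-positive of order `n`** (⇐: a box-TP₂ law on `Q_d` extended by `0` is box-TP₂ on the cube,
  `IsBoxTP2.map_finExtend_zero`, and generation 11's `liebSahiContinuum_iff_isBoxTP2`).

HONEST FRAMING (cell rule): `LiebSahiContinuum d n` (`d, n ≥ 3`) and `SahiConjecture n` (`n ≥ 3`) are OPEN and enter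
only as hypotheses; the unconditional content is `n ≤ 2`.  FKG/association for measures with lattice conditions on
general product spaces: cf. Batty–Bollmann 1980 [cite: BattyBollmann1980], Karlin–Rinott 1980 (MTP₂ densities); the
box form for singular laws on the Hilbert cube and the `E_n` consequences are this work.  No sorries, no new axioms.
-/

noncomputable section

namespace Summit.CriticalPhenomena.PercolationContinuityZ3.Theorems.SahiBoxTP2

open MeasureTheory ProbabilityTheory Set Filter Topology Function Literature.Combinatorics.Sahi2008
open scoped ENNReal unitInterval

/-! ### Box-TP₂ laws on the Hilbert cube are Sahi-positive (given the continuous case) -/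

section BoxTP2

variable {n : ℕ}

/-- **`(∀ d, LiebSahiContinuum d n)` ⟹ every box-TP₂ probability measure on the Hilbert cube `ℕ → [0,1]` is
Sahi-positive of order `n`**: `E_n(f_0,…,f_{n−1}) ≥ 0` for ALL measurable nonnegative monotone `f_i` (no density,
no continuity, singular laws allowed; monotone functions on the cube are bounded by their value at the top
configuration).  Infinite-dimensional version of `msahiE_nonneg_of_isBoxTP2`. [this work] -/
theorem msahiE_nonneg_of_isBoxTP2_hilbert (hL : ∀ d, LiebSahiContinuum d n) (μ : Measure (ℕ → I))
    [IsProbabilityMeasure μ] (hμ : IsBoxTP2 μ) (f : Fin n → (ℕ → I) → ℝ) (hfm : ∀ i, Measurable (f i))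
    (hf0 : ∀ i u, 0 ≤ f i u) (hmono : ∀ i, Monotone (f i)) : 0 ≤ msahiE μ n f := by
  obtain ⟨G, S, hGm, hS, hG, hGμ⟩ := exists_aemonotone_coupling_hilbert μ hμ
  rw [← hGμ]
  have hfC : ∀ i u, f i u ≤ ∑ j, f j (fun _ => 1) := fun i u =>
    (hmono i fun k => unitInterval.le_one (u k)).trans
      (Finset.single_le_sum (fun j _ => hf0 j _) (Finset.mem_univ i))
  exact msahiE_map_lebesgueHilbert_nonneg_of_monotoneOn hL hGm hS hG f hfm hf0 hfC hmono

/-- **From `C_n`**: Sahi's conjecture of order `n` (`SahiConjecture n ↔ ∀ d, LiebSahiContinuum d n`) gives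
`E_n ≥ 0` under every box-TP₂ law on the Hilbert cube for all measurable nonnegative monotone families.
[this work; cite: Sahi2008, Conj. 5 (p. 212); LiebSahi2021, Conj. 1.1] -/
theorem msahiE_nonneg_of_isBoxTP2_hilbert_of_sahiConjecture (hC : SahiConjecture n) (μ : Measure (ℕ → I))
    [IsProbabilityMeasure μ] (hμ : IsBoxTP2 μ) (f : Fin n → (ℕ → I) → ℝ) (hfm : ∀ i, Measurable (f i))
    (hf0 : ∀ i u, 0 ≤ f i u) (hmono : ∀ i, Monotone (f i)) : 0 ≤ msahiE μ n f :=
  msahiE_nonneg_of_isBoxTP2_hilbert ((sahiConjecture_iff_forall_liebSahiContinuum n).1 hC) μ hμ f hfm hf0 hmono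

/-! #### Decreasing families: reflect every coordinate -/

/-- Coordinatewise reflection `u ↦ (1 − u_k)_k` of the Hilbert cube, as a measurable equivalence. -/
def reflectHilbert : (ℕ → I) ≃ᵐ (ℕ → I) := MeasurableEquiv.piCongrRight fun _ : ℕ => unitInterval.symmMeasurableEquiv

/-- The reflection reverses the order. [folklore] -/
theorem reflectHilbert_antitone : Antitone reflectHilbert := fun u v huv k => by
  change unitInterval.symm (v k) ≤ unitInterval.symm (u k)
  exact unitInterval.symm_le_symm.2 (huv k)

/-- The reflection is an involution. [folklore] -/
theorem reflectHilbert_reflectHilbert (u : ℕ → I) : reflectHilbert (reflectHilbert u) = u := by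
  funext k
  exact unitInterval.symm_symm (u k)

/-- The reflection maps boxes to boxes (with reflected, swapped corners). [folklore] -/
theorem reflectHilbert_preimage_Icc (a b : ℕ → I) :
    reflectHilbert ⁻¹' Icc a b = Icc (reflectHilbert b) (reflectHilbert a) := by
  ext u
  simp only [mem_preimage, mem_Icc, Pi.le_def]
  change (∀ k, a k ≤ unitInterval.symm (u k)) ∧ (∀ k, unitInterval.symm (u k) ≤ b k) ↔
    (∀ k, unitInterval.symm (b k) ≤ u k) ∧ (∀ k, u k ≤ unitInterval.symm (a k))
  constructor
  · rintro ⟨h1, h2⟩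
    exact ⟨fun k => by simpa using unitInterval.symm_le_symm.2 (h2 k),
      fun k => by simpa using unitInterval.symm_le_symm.2 (h1 k)⟩
  · rintro ⟨h1, h2⟩
    exact ⟨fun k => by simpa using unitInterval.symm_le_symm.2 (h2 k),
      fun k => by simpa using unitInterval.symm_le_symm.2 (h1 k)⟩

/-- The reflection exchanges meets and joins. [folklore] -/
theorem reflectHilbert_inf (a b : ℕ → I) : reflectHilbert (a ⊓ b) = reflectHilbert a ⊔ reflectHilbert b := by
  funext k
  change unitInterval.symm (a k ⊓ b k) = unitInterval.symm (a k) ⊔ unitInterval.symm (b k)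
  exact unitInterval.strictAnti_symm.antitone.map_min

/-- The reflection exchanges joins and meets. [folklore] -/
theorem reflectHilbert_sup (a b : ℕ → I) : reflectHilbert (a ⊔ b) = reflectHilbert a ⊓ reflectHilbert b := by
  funext k
  change unitInterval.symm (a k ⊔ b k) = unitInterval.symm (a k) ⊓ unitInterval.symm (b k)
  exact unitInterval.strictAnti_symm.antitone.map_max

/-- **Box-TP₂ is invariant under the coordinatewise reflection.** [this work] -/
theorem IsBoxTP2.map_reflectHilbert {μ : Measure (ℕ → I)} (hμ : IsBoxTP2 μ) : IsBoxTP2 (μ.map reflectHilbert) := by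
  intro a b a' b'
  simp only [Measure.map_apply reflectHilbert.measurable measurableSet_Icc, reflectHilbert_preimage_Icc,
    reflectHilbert_inf, reflectHilbert_sup]
  have key := hμ (reflectHilbert b) (reflectHilbert a) (reflectHilbert b') (reflectHilbert a')
  rwa [mul_comm (μ (Icc (reflectHilbert b ⊓ reflectHilbert b') (reflectHilbert a ⊓ reflectHilbert a')))] at key

/-- The reflection is measure preserving from `μ ∘ reflect⁻¹` back to `μ` (it is an involution). [folklore] -/
theorem measurePreserving_reflectHilbert (μ : Measure (ℕ → I)) :
    MeasurePreserving reflectHilbert (μ.map reflectHilbert) μ := by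
  refine ⟨reflectHilbert.measurable, ?_⟩
  rw [Measure.map_map reflectHilbert.measurable reflectHilbert.measurable]
  convert Measure.map_id (μ := μ) using 2
  funext u
  exact reflectHilbert_reflectHilbert u

/-- **Decreasing families** (Lieb–Sahi's printed orientation): under the same hypothesis `E_n(f_0,…,f_{n−1}) ≥ 0` for
all measurable nonnegative ANTITONE `f_i` on the Hilbert cube, for every box-TP₂ law (reflect every coordinate: the
reflected law is box-TP₂ and the reflected family increasing). [this work] -/
theorem msahiE_nonneg_of_isBoxTP2_hilbert_antitone (hL : ∀ d, LiebSahiContinuum d n) (μ : Measure (ℕ → I))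
    [IsProbabilityMeasure μ] (hμ : IsBoxTP2 μ) (f : Fin n → (ℕ → I) → ℝ) (hfm : ∀ i, Measurable (f i))
    (hf0 : ∀ i u, 0 ≤ f i u) (hanti : ∀ i, Antitone (f i)) : 0 ≤ msahiE μ n f := by
  haveI : IsProbabilityMeasure (μ.map reflectHilbert) :=
    Measure.isProbabilityMeasure_map reflectHilbert.measurable.aemeasurable
  rw [← msahiE_comp_measurePreserving (measurePreserving_reflectHilbert μ) reflectHilbert.measurableEmbedding n f]
  exact msahiE_nonneg_of_isBoxTP2_hilbert hL (μ.map reflectHilbert) hμ.map_reflectHilbert (fun i => f i ∘ reflectHilbert)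
    (fun i => (hfm i).comp reflectHilbert.measurable) (fun i u => hf0 i _)
    fun i u v huv => hanti i (reflectHilbert_antitone huv)

/-- Decreasing families, from `C_n`. [this work] -/
theorem msahiE_nonneg_of_isBoxTP2_hilbert_antitone_of_sahiConjecture (hC : SahiConjecture n) (μ : Measure (ℕ → I))
    [IsProbabilityMeasure μ] (hμ : IsBoxTP2 μ) (f : Fin n → (ℕ → I) → ℝ) (hfm : ∀ i, Measurable (f i))
    (hf0 : ∀ i u, 0 ≤ f i u) (hanti : ∀ i, Antitone (f i)) : 0 ≤ msahiE μ n f :=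
  msahiE_nonneg_of_isBoxTP2_hilbert_antitone ((sahiConjecture_iff_forall_liebSahiContinuum n).1 hC) μ hμ f hfm hf0
    hanti

/-! #### Unconditional layers -/

/-- **Unconditionally, `n ≤ 2`: the FKG inequality for box-TP₂ laws on the Hilbert cube** — every box-TP₂
probability measure on `ℕ → [0,1]` (singular laws included) satisfies `E_1, E_2 ≥ 0`, i.e. is positively associated
for all measurable nonnegative monotone functions. [this work] -/
theorem msahiE_nonneg_of_isBoxTP2_hilbert_of_le_two (hn : n ≤ 2) (μ : Measure (ℕ → I)) [IsProbabilityMeasure μ]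
    (hμ : IsBoxTP2 μ) (f : Fin n → (ℕ → I) → ℝ) (hfm : ∀ i, Measurable (f i)) (hf0 : ∀ i u, 0 ≤ f i u)
    (hmono : ∀ i, Monotone (f i)) : 0 ≤ msahiE μ n f :=
  msahiE_nonneg_of_isBoxTP2_hilbert (fun d => liebSahiContinuum_of_order_le_two d hn) μ hμ f hfm hf0 hmono

/-- **The FKG inequality for box-TP₂ laws on the Hilbert cube**, covariance form: `∫ f ∫ g ≤ ∫ f g` for measurable
nonnegative monotone `f, g` under every box-TP₂ probability measure on `ℕ → [0,1]`. [this work] -/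
theorem integral_mul_integral_le_of_isBoxTP2_hilbert (μ : Measure (ℕ → I)) [IsProbabilityMeasure μ]
    (hμ : IsBoxTP2 μ) {f g : (ℕ → I) → ℝ} (hfm : Measurable f) (hgm : Measurable g) (hf0 : ∀ u, 0 ≤ f u)
    (hg0 : ∀ u, 0 ≤ g u) (hf : Monotone f) (hg : Monotone g) :
    (∫ u, f u ∂μ) * (∫ u, g u ∂μ) ≤ ∫ u, f u * g u ∂μ := by
  have h := msahiE_nonneg_of_isBoxTP2_hilbert_of_le_two le_rfl μ hμ ![f, g]
    (fun i => by fin_cases i <;> assumption) (fun i => by fin_cases i <;> assumption)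
    (fun i => by fin_cases i <;> assumption)
  rw [msahiE_two] at h
  linarith

/-! #### The equivalence with Sahi's conjecture -/

/-- Extension of a point of `Q_d` to the Hilbert cube by `0`, as a map. [folklore] -/
theorem measurable_finExtend_zero (d : ℕ) : Measurable fun x : Fin d → I => finExtend d x (0 : I) :=
  measurable_pi_lambda _ fun i => by
    by_cases hi : i < d
    · simp only [finExtend, dif_pos hi]; exact measurable_pi_apply _
    · simp only [finExtend, dif_neg hi]; exact measurable_const

/-- The free coordinates of the extension by `0` vanish, so a box `[a,b]` of the Hilbert cube with `a_i = 0` for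
`i ≥ d` pulls back to the box `[a|_d, b|_d]` of `Q_d`. [folklore] -/
theorem finExtend_zero_preimage_Icc_of_forall (d : ℕ) {a : ℕ → I} (b : ℕ → I) (hP : ∀ i, d ≤ i → a i = 0) :
    (fun x : Fin d → I => finExtend d x (0 : I)) ⁻¹' Icc a b = Icc (finRestrict d a) (finRestrict d b) := by
  ext x
  simp only [mem_preimage, mem_Icc, Pi.le_def, finRestrict_apply]
  constructor
  · rintro ⟨h1, h2⟩
    refine ⟨fun i => ?_, fun i => ?_⟩
    · have := h1 i; rwa [finExtend_of_lt x 0 i.2] at this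
    · have := h2 i; rwa [finExtend_of_lt x 0 i.2] at this
  · rintro ⟨h1, h2⟩
    refine ⟨fun i => ?_, fun i => ?_⟩
    · by_cases hi : i < d
      · rw [finExtend_of_lt x 0 hi]; exact h1 ⟨i, hi⟩
      · rw [finExtend_of_le x 0 (not_lt.1 hi), hP i (not_lt.1 hi)]
    · by_cases hi : i < d
      · rw [finExtend_of_lt x 0 hi]; exact h2 ⟨i, hi⟩
      · rw [finExtend_of_le x 0 (not_lt.1 hi)]; exact bot_le

/-- … and a box with some `a_i > 0`, `i ≥ d`, pulls back to `∅`. [folklore] -/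
theorem finExtend_zero_preimage_Icc_of_not (d : ℕ) {a : ℕ → I} (b : ℕ → I) (hP : ¬ ∀ i, d ≤ i → a i = 0) :
    (fun x : Fin d → I => finExtend d x (0 : I)) ⁻¹' Icc a b = ∅ := by
  refine Set.eq_empty_of_forall_notMem fun x hx => hP fun i hi => ?_
  have h1 : a i ≤ finExtend d x 0 i := hx.1 i
  rw [finExtend_of_le x 0 hi] at h1
  exact le_antisymm h1 bot_le

/-- **A box-TP₂ law on `Q_d`, extended by `0`, is a box-TP₂ law on the Hilbert cube.** [this work] -/
theorem IsBoxTP2.map_finExtend_zero {d : ℕ} {ν : Measure (Fin d → I)} (hν : IsBoxTP2 ν) :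
    IsBoxTP2 (ν.map fun x : Fin d → I => finExtend d x (0 : I)) := by
  intro a b a' b'
  simp only [Measure.map_apply (measurable_finExtend_zero d) measurableSet_Icc]
  by_cases hP : ∀ i, d ≤ i → a i = 0
  · by_cases hP' : ∀ i, d ≤ i → a' i = 0
    · have hPi : ∀ i, d ≤ i → (a ⊓ a') i = 0 := fun i hi => by
        rw [Pi.inf_apply, hP i hi, hP' i hi, inf_idem]
      have hPs : ∀ i, d ≤ i → (a ⊔ a') i = 0 := fun i hi => by
        rw [Pi.sup_apply, hP i hi, hP' i hi, sup_idem]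
      rw [finExtend_zero_preimage_Icc_of_forall d b hP, finExtend_zero_preimage_Icc_of_forall d b' hP',
        finExtend_zero_preimage_Icc_of_forall d _ hPi, finExtend_zero_preimage_Icc_of_forall d _ hPs]
      exact hν (finRestrict d a) (finRestrict d b) (finRestrict d a') (finRestrict d b')
    · rw [finExtend_zero_preimage_Icc_of_not d b' hP', measure_empty, mul_zero]; exact zero_le
  · rw [finExtend_zero_preimage_Icc_of_not d b hP, measure_empty, zero_mul]; exact zero_le

/-- **SAHI'S CONJECTURE `C_n` ⟺ every box-TP₂ probability measure on the Hilbert cube is Sahi-positive of order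
`n`** for all measurable nonnegative monotone families (⇒: the coupling theorem; ⇐: a box-TP₂ law on `Q_d` extended by
`0` is a box-TP₂ law on the cube, and `liebSahiContinuum_iff_isBoxTP2`). [this work; cite: Sahi2008, Conj. 5 (p. 212); LiebSahi2021, Conj. 1.1] -/
theorem sahiConjecture_iff_forall_isBoxTP2_hilbert (n : ℕ) :
    SahiConjecture n ↔ ∀ μ : Measure (ℕ → I), IsProbabilityMeasure μ → IsBoxTP2 μ →
      ∀ f : Fin n → (ℕ → I) → ℝ, (∀ i, Measurable (f i)) → (∀ i u, 0 ≤ f i u) → (∀ i, Monotone (f i)) →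
        0 ≤ msahiE μ n f := by
  refine ⟨fun hC μ hμP hμ f hfm hf0 hmono => ?_, fun h => ?_⟩
  · haveI := hμP
    exact msahiE_nonneg_of_isBoxTP2_hilbert_of_sahiConjecture hC μ hμ f hfm hf0 hmono
  · refine (sahiConjecture_iff_forall_liebSahiContinuum n).2 fun d => liebSahiContinuum_iff_isBoxTP2.2 ?_
    intro ν hνP hν g hgm hg0 hgmono
    haveI := hνP
    set ext : (Fin d → I) → (ℕ → I) := fun x => finExtend d x (0 : I) with hext
    haveI : IsProbabilityMeasure (ν.map ext) := Measure.isProbabilityMeasure_map (measurable_finExtend_zero d).aemeasurable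
    have hmp : MeasurePreserving ext ν (ν.map ext) := ⟨measurable_finExtend_zero d, rfl⟩
    have key := h (ν.map ext) inferInstance hν.map_finExtend_zero (fun i => g i ∘ finRestrict d)
      (fun i => (hgm i).comp (measurable_finRestrict d)) (fun i u => hg0 i _)
      fun i u v huv => hgmono i (finRestrict_mono d huv)
    rw [← msahiE_comp_measurePreserving_of_measurable hmp n _ fun i => (hgm i).comp (measurable_finRestrict d)] at key
    have e : (fun i => (g i ∘ finRestrict d) ∘ ext) = g := by
      funext i x
      simp only [Function.comp_apply, hext, finRestrict_finExtend]
    rwa [e] at key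

end BoxTP2

end Summit.CriticalPhenomena.PercolationContinuityZ3.Theorems.SahiBoxTP2
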